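import Summits.BirchSwinnertonDyer.BirchSwinnertonDyer.Theorems.SignedBaseChangeAnticyclotomicEisensteinDivisibilityAdmdefToricOrdinary
import Summits.BirchSwinnertonDyer.BirchSwinnertonDyer.Theorems.AdditiveKolyvaginRoadSwitchedEigen
import Summits.BirchSwinnertonDyer.BirchSwinnertonDyer.Theorems.AdditiveKolyvaginRoadKolyvaginToricConj
import HarnessLib

/-!
# Line `admdef` (crux `AnticyclotomicEisensteinDivisibility`, stmt-BirchSwinnertonDyer-20727), rigidity road: the ZERO-VERTEX DICTIONARY between
# the anchor's currency (AKR: `SelQP W K p c s ± = ⊥`, W. Zhang's eigen-Selmer spaces in `H¹(K, E[p])`) and the signed bipartite system's currency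
# (CHKLL25: `Sel^ε_{∏s}(K_0, E[p]) = 0`), on cell β

LEAD seat bsd-line-sbc-p1 (gen 32), `--supports stmt-BirchSwinnertonDyer-20727` (helper; OFF the v24 composition path).  The anchor (K1 = item
stmt-BirchSwinnertonDyer-33118) speaks of the odd ZERO VERTICES `∀ μ, AdditiveKoly.SelQP W K p c n μ = ⊥` of W. Zhang's level-raised Selmer walk;
Howard's rigidity for CHKLL25's signed system (`…AdmdefHowardVanishing`, `…AdmdefKolyvaginVertex`, and the sequel `…AdmdefHowardRigidity`) speaks of
`signedOrdSelmerTorsion (W⁄K) p κ ε (∏ n) 0 1`.  With LEAD g32's level-`n` dictionary (`…AdmdefToricOrdinary` §4: `T X ∈ Sel^ε_{∏s}(K_0, E[p]) ⟺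
X ∈ D_s`, `D_s` = «Kummer at ∞ and off `s`, toric at `s`», the sign-free level space) the two currencies are identified:

* §1 the sign-free level space `D_s` written as the three non-sign blocks of `AdditiveKoly.levelSelmerSubgroupP (s.image val) ∅ μ` (so that
  `levelSelmerSubgroupP … μ = ker(c − sgn μ) ⊓ D_s` is `rfl`), its membership lemma, and its STABILITY under complex conjugation `c`
  (`conjAct_mem_levelBlocks`: Kummer conditions transported along `K_v ≃ K_{c v}` — tree `conjAct_mem_selmerLocalKer_iff`; toric conditions by AKR
  `conjAct_mem_toricLocalKer_adicCompletion_iff`; naturals lie under `c • v` iff under `v`).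
* §2 `mem_levelBlocks_iff_resH1Hom_mem` — `X ∈ D_s ⟺ T X ∈ Sel^ε_{∏s}(K_0, E[p])` on cell β (all-ramified, {HLV 2022 Lemma 3.7 local}, `AcSigned.Setting`).
* §3 ★ `forall_eq_zero_of_selQP_eq_bot` — `(∀ μ, SelQP s μ = ⊥) ⟹ Sel^ε_{∏s}(K_0, E[p]) = 0` (eigen-decomposition `x = u(x + cx) + u(x − cx)`, `2u ≡ 1
  (mod p)`, of the `c`-stable `D_s`; `T` onto); ★ `selQP_eq_bot_of_forall_eq_zero` — the converse (`T` injective).  So «odd zero vertex» means the same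
  thing in both currencies: `selQP_eq_bot_iff_forall_eq_zero`.

HONEST FRAMING: theorems only (0 definitions, 0 named facts introduced, 0 `sorry`; standard axioms); CONDITIONAL on the displayed named fact {HLV 2022
Lemma 3.7, local form} (audit `proof.conditional`); nothing about the crux, the anchors or BSD is asserted; no summit statement is proved.

References: [cite: WZhang2014, §4.1, §5 (Sel^±_{𝔭_n}), §9 (9.2)] [cite: CastellaEtAl2025, §7.2 (arXiv:2308.10474v2 p0030 L16–L27)] [cite: GrossLMS1991, §5 (5.1), §10]
[cite: BertoliniDarmon2005, §2.2–§2.3] [cite: HatleyLeiVigni2022, Lemma 3.7]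
-/

-- D-0017: single-problem summit, the namespace repeats the problem name by design.
set_option linter.dupNamespace false
set_option autoImplicit false

noncomputable section

open scoped Classical NumberField Pointwise

namespace Summit.BirchSwinnertonDyer.BirchSwinnertonDyer.Theorems.SignedBaseChangeAcDivAdmdefZeroVertexDictionary

open WeierstrassCurve NumberField IsDedekindDomain Field Module
open Literature.NumberTheory.EllipticCurves Literature.NumberTheory.GaloisRepresentations
open Literature.NumberTheory.EllipticCurves.CastellaHsuKunduLeeLiu2025
open Literature.NumberTheory.EllipticCurves.BertoliniDarmon2005
open Literature.NumberTheory.EllipticCurves.AcSigned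
open Literature.NumberTheory.Automorphic
open Summit.BirchSwinnertonDyer.BirchSwinnertonDyer.Theorems.AdditiveKoly
open Summit.BirchSwinnertonDyer.BirchSwinnertonDyer.Theorems.SignedBaseChangeAcDivAdmdefCoreRootOfSeenAnchor
open Summit.BirchSwinnertonDyer.BirchSwinnertonDyer.Theorems.SignedBaseChangeAcDivAdmdefLayerZeroDictionary
open Summit.BirchSwinnertonDyer.BirchSwinnertonDyer.Theorems.SignedBaseChangeAcDivAdmdefToricOrdinary
open scoped ContRepresentation

universe u

/-! ## §1 The sign-free level space `D_s` (three blocks of `levelSelmerSubgroupP`), membership, stability under `c` -/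

section Blocks

variable {K : Type} [Field K] [NumberField K] (W : WeierstrassCurve ℚ) [W.IsElliptic] [W.IsGloballyMinimal] (p : ℕ) [Fact p.Prime]
  (c : K ≃ₐ[ℚ] K)

omit [W.IsElliptic] [W.IsGloballyMinimal] [Fact p.Prime] in
/-- `levelSelmerSubgroupP n ∅ μ` is the `sgn μ`-eigenspace of `c` cut by the sign-free level space (its last three blocks) — definitional.
[cite: WZhang2014, §5 (Sel^±_{𝔭_n})] -/
theorem levelSelmerSubgroupP_eq_ker_inf (n : Finset ℕ) (μ : Bool) :
    levelSelmerSubgroupP W K p c n ∅ μ =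
      (conjAct W c ((p ^ 1 : ℕ) : ℤ) - sgnP μ • AddMonoidHom.id (Vp W K p)).ker ⊓
      ((⨅ (w : InfinitePlace K), selmerLocalKer (W.baseChange K) w.Completion ((p ^ 1 : ℕ) : ℤ)) ⊓
      ((⨅ (v : HeightOneSpectrum (𝓞 K)) (_ : ∀ q ∈ (n : Set ℕ) ∪ (∅ : Set ℕ), (q : 𝓞 K) ∉ v.asIdeal),
          selmerLocalKer (W.baseChange K) (v.adicCompletion K) ((p ^ 1 : ℕ) : ℤ)) ⊓
      (⨅ (q : ℕ) (_ : q ∈ n ∧ q ∉ (∅ : Set ℕ)) (v : HeightOneSpectrum (𝓞 K)) (_ : (q : 𝓞 K) ∈ v.asIdeal),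
          toricLocalKer (W.baseChange K) (v.adicCompletion K) ((p ^ 1 : ℕ) : ℤ)))) := rfl

omit [W.IsElliptic] [W.IsGloballyMinimal] [Fact p.Prime] in
/-- Membership in the sign-free level space `D_n` (the three non-sign blocks of `levelSelmerSubgroupP n ∅ ·`): Kummer at the infinite places, Kummer at
the finite places above no prime of `n`, TORIC at the places above the primes of `n`. [cite: WZhang2014, §4.1, §5] [cite: BertoliniDarmon2005, §2.3] -/
theorem mem_levelBlocks_iff (n : Finset ℕ) (x : Vp W K p) :
    x ∈ ((⨅ (w : InfinitePlace K), selmerLocalKer (W.baseChange K) w.Completion ((p ^ 1 : ℕ) : ℤ)) ⊓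
      ((⨅ (v : HeightOneSpectrum (𝓞 K)) (_ : ∀ q ∈ (n : Set ℕ) ∪ (∅ : Set ℕ), (q : 𝓞 K) ∉ v.asIdeal),
          selmerLocalKer (W.baseChange K) (v.adicCompletion K) ((p ^ 1 : ℕ) : ℤ)) ⊓
      (⨅ (q : ℕ) (_ : q ∈ n ∧ q ∉ (∅ : Set ℕ)) (v : HeightOneSpectrum (𝓞 K)) (_ : (q : 𝓞 K) ∈ v.asIdeal),
          toricLocalKer (W.baseChange K) (v.adicCompletion K) ((p ^ 1 : ℕ) : ℤ)))) ↔
      (∀ w : InfinitePlace K, x ∈ selmerLocalKer (W.baseChange K) w.Completion ((p ^ 1 : ℕ) : ℤ)) ∧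
      (∀ v : HeightOneSpectrum (𝓞 K), (∀ q ∈ n, (q : 𝓞 K) ∉ v.asIdeal) →
        x ∈ selmerLocalKer (W.baseChange K) (v.adicCompletion K) ((p ^ 1 : ℕ) : ℤ)) ∧
      (∀ q ∈ n, ∀ v : HeightOneSpectrum (𝓞 K), (q : 𝓞 K) ∈ v.asIdeal →
        x ∈ toricLocalKer (W.baseChange K) (v.adicCompletion K) ((p ^ 1 : ℕ) : ℤ)) := by
  simp only [AddSubgroup.mem_inf, AddSubgroup.mem_iInf, Set.union_empty, Finset.mem_coe, Set.mem_empty_iff_false, not_false_eq_true,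
    and_true]

omit [W.IsElliptic] [W.IsGloballyMinimal] [Fact p.Prime] in
/-- **The sign-free level space `D_n` is stable under complex conjugation** (any `c ∈ Aut(K/ℚ)`, `K` with complex infinite places): `c` permutes the
places above no prime of `n` and those above a given `q ∈ n` (a natural lies under `c • v` iff under `v`), transporting Kummer conditions (tree
`conjAct_mem_selmerLocalKer_iff`) and toric conditions (AKR `conjAct_mem_toricLocalKer_adicCompletion_iff`) along `K_v ≃ K_{c v}`; at the complex places
the Kummer condition is everything.  [cite: GrossLMS1991, §5 (5.1)] [cite: WZhang2014, §9 (9.2)] -/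
theorem conjAct_mem_levelBlocks (hKc : ∀ w : InfinitePlace K, w.IsComplex) (n : Finset ℕ) {x : Vp W K p}
    (hx : x ∈ ((⨅ (w : InfinitePlace K), selmerLocalKer (W.baseChange K) w.Completion ((p ^ 1 : ℕ) : ℤ)) ⊓
      ((⨅ (v : HeightOneSpectrum (𝓞 K)) (_ : ∀ q ∈ (n : Set ℕ) ∪ (∅ : Set ℕ), (q : 𝓞 K) ∉ v.asIdeal),
          selmerLocalKer (W.baseChange K) (v.adicCompletion K) ((p ^ 1 : ℕ) : ℤ)) ⊓
      (⨅ (q : ℕ) (_ : q ∈ n ∧ q ∉ (∅ : Set ℕ)) (v : HeightOneSpectrum (𝓞 K)) (_ : (q : 𝓞 K) ∈ v.asIdeal),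
          toricLocalKer (W.baseChange K) (v.adicCompletion K) ((p ^ 1 : ℕ) : ℤ))))) :
    conjAct W c ((p ^ 1 : ℕ) : ℤ) x ∈
      ((⨅ (w : InfinitePlace K), selmerLocalKer (W.baseChange K) w.Completion ((p ^ 1 : ℕ) : ℤ)) ⊓
      ((⨅ (v : HeightOneSpectrum (𝓞 K)) (_ : ∀ q ∈ (n : Set ℕ) ∪ (∅ : Set ℕ), (q : 𝓞 K) ∉ v.asIdeal),
          selmerLocalKer (W.baseChange K) (v.adicCompletion K) ((p ^ 1 : ℕ) : ℤ)) ⊓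
      (⨅ (q : ℕ) (_ : q ∈ n ∧ q ∉ (∅ : Set ℕ)) (v : HeightOneSpectrum (𝓞 K)) (_ : (q : 𝓞 K) ∈ v.asIdeal),
          toricLocalKer (W.baseChange K) (v.adicCompletion K) ((p ^ 1 : ℕ) : ℤ)))) := by
  -- adapted from Theorems/AdditiveKolyvaginRoadSwitchedEigen.lean `conjAct_mem_switchedTotal` (+ the toric block)
  rw [mem_levelBlocks_iff] at hx ⊢
  obtain ⟨-, hfin, htor⟩ := hx
  refine ⟨fun w ↦ ?_, fun v' hv' ↦ ?_, fun q hq v' hqv' ↦ ?_⟩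
  · haveI : IsAlgClosed w.Completion :=
      isAlgClosed_of_ringEquiv (InfinitePlace.Completion.ringEquivComplexOfIsComplex (hKc w)).symm
    rw [WeierstrassCurve.selmerLocalKer_eq_top_of_isAlgClosed]
    trivial
  · have h : c • (c⁻¹ • v') = v' := smul_inv_smul c v'
    haveI : CharZero ((c⁻¹ • v').adicCompletion K) := charZero_of_injective_algebraMap (algebraMap K _).injective
    haveI : CharZero (v'.adicCompletion K) := charZero_of_injective_algebraMap (algebraMap K _).injective
    refine (conjAct_mem_selmerLocalKer_iff W c (galAdicCompletionEquiv (L := K) c h)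
      (isSemilinearRingEquiv_galAdicCompletionEquiv c h) _ x).mpr (hfin (c⁻¹ • v') fun q hq hq' ↦ ?_)
    exact hv' q hq (by rwa [natCast_mem_smul_asIdeal_iff] at hq')
  · have h : c • (c⁻¹ • v') = v' := smul_inv_smul c v'
    refine (conjAct_mem_toricLocalKer_adicCompletion_iff W c h _ x).mpr (htor q hq (c⁻¹ • v') ?_)
    rwa [natCast_mem_smul_asIdeal_iff]

end Blocks

/-! ## §2 `D_s = T⁻¹(Sel^ε_{∏s}(K_0, E[p]))` on cell β -/

section Dictionary

variable {K : Type} [Field K] [NumberField K] (W : WeierstrassCurve ℚ) [W.IsElliptic] [W.IsGloballyMinimal] {p : ℕ} [Fact p.Prime]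
  (κ : ZpExtension K p) {𝔭 𝔭' : HeightOneSpectrum (𝓞 K)}

/-- **`X ∈ D_s ⟺ T X ∈ Sel^ε_{∏s}(K_0, E[p])` on cell β** (the level-`n` dictionary of `…AdmdefToricOrdinary` §4 with the automatic archimedean Kummer
condition of the imaginary quadratic `K` added).  Hypotheses: `AcSigned.Setting`, (Heeg) for `N_E`, {HLV 2022 Lemma 3.7, local form}, `p ≥ 5`,
`(N : ℤ) = N_E`, `(N, d_K) = 1`, binder (ii) «`E[p]` ramified at every `q ∣ N`». [cite: CastellaEtAl2025, §7.2, Thm. 7.1 (ii)] [cite: HatleyLeiVigni2022, Lemma 3.7]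
[cite: GrossLMS1991, §7 (7.1)] -/
theorem mem_levelBlocks_iff_resH1Hom_mem (hS : Setting W K p κ 𝔭 𝔭') (hH : SatisfiesHeegnerHypothesis (W.conductorNorm ℤ) K)
    (hloc : hatleyLeiVigni2022_lemma37_local_signedCondition_eq_kummer W K p κ 𝔭 𝔭') (h5 : 5 ≤ p) {N : ℕ} (hN : (N : ℤ) = W.conductorNorm ℤ)
    (hND : IsCoprime (N : ℤ) (NumberField.discr K))
    (hall : ∀ q : ℕ, q.Prime → q ∣ N → ∃ v' : HeightOneSpectrum (𝓞 ℚ), ((q : ℕ) : 𝓞 ℚ) ∈ v'.asIdeal ∧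
      ∃ 𝔓 ∈ v'.primesAbove, ∃ σ ∈ 𝔓.inertia (absoluteGaloisGroup ℚ), ∃ P : W.geomTorsion (p : ℤ), σ • P ≠ P)
    (ε : ℤˣ) (s : Finset (AdmQ W K p)) (X : Vp W K p) :
    X ∈ ((⨅ (w : InfinitePlace K), selmerLocalKer (W.baseChange K) w.Completion ((p ^ 1 : ℕ) : ℤ)) ⊓
      ((⨅ (v : HeightOneSpectrum (𝓞 K)) (_ : ∀ q ∈ ((s.image Subtype.val : Finset ℕ) : Set ℕ) ∪ (∅ : Set ℕ), (q : 𝓞 K) ∉ v.asIdeal),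
          selmerLocalKer (W.baseChange K) (v.adicCompletion K) ((p ^ 1 : ℕ) : ℤ)) ⊓
      (⨅ (q : ℕ) (_ : q ∈ s.image Subtype.val ∧ q ∉ (∅ : Set ℕ)) (v : HeightOneSpectrum (𝓞 K)) (_ : (q : 𝓞 K) ∈ v.asIdeal),
          toricLocalKer (W.baseChange K) (v.adicCompletion K) ((p ^ 1 : ℕ) : ℤ)))) ↔
      resH1Hom (Literature.NumberTheory.EllipticCurves.subgroupIncl (κ.layerSubgroup 0))
          (AddSubgroup.inclusion (geomTorsion_natCast_pow_one W (K := K) (p := p)).le) (fun _ _ ↦ rfl) X ∈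
        signedOrdSelmerTorsion (W.baseChange K) p κ ε (∏ q ∈ s, (q : ℕ)) 0 1 := by
  rw [mem_levelBlocks_iff, resH1Hom_layerZero_mem_signedOrdSelmerTorsion_iff_of_allRamified W κ hS hH hloc h5 hN hND hall ε s X]
  constructor
  · rintro ⟨-, hfin, htor⟩
    refine ⟨fun v hv ↦ hfin v fun q hq ↦ ?_, fun q hq v hqv ↦ htor (q : ℕ) (Finset.mem_image_of_mem _ hq) v hqv⟩
    obtain ⟨a, ha, rfl⟩ := Finset.mem_image.mp hq
    exact hv a ha
  · rintro ⟨hfin, htor⟩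
    refine ⟨fun w ↦ mem_selmerLocalKer_infinitePlace_of_isImaginaryQuadratic hS.isImaginaryQuadratic _ w X,
      fun v hv ↦ hfin v fun a ha ↦ hv (a : ℕ) (Finset.mem_image_of_mem _ ha), fun q hq v hqv ↦ ?_⟩
    obtain ⟨a, ha, rfl⟩ := Finset.mem_image.mp hq
    exact htor a ha v hqv

end Dictionary

/-! ## §3 Zero vertices: `SelQP s ± = ⊥ ⟺ Sel^ε_{∏s}(K_0, E[p]) = 0` -/

section Zero

variable {K : Type} [Field K] [NumberField K] (W : WeierstrassCurve ℚ) [W.IsElliptic] [W.IsGloballyMinimal] {p : ℕ} [Fact p.Prime]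
  (κ : ZpExtension K p) {𝔭 𝔭' : HeightOneSpectrum (𝓞 K)} (c : K ≃ₐ[ℚ] K) [Module (ZMod p) (Vp W K p)]

/-- ★ **An AKR zero vertex is a CHKLL zero vertex**: on cell β (hypotheses of §2) with `c ≠ 1`, if both eigen-spaces `SelQP W K p c s ±` vanish then
every class of `Sel^ε_{∏s}(K_0, E[p])` is zero.  Proof: a class is `T X` (`T` onto) with `X ∈ D_s` (§2); `D_s` is `c`-stable (§1), so `X ± cX` lie in
the two eigen-cuts `ker(c ∓ 1) ⊓ D_s = levelSelmerSubgroupP (s.image val) ∅ ± ⊆ SelQP s ± = 0`; and `X = u((X + cX) + (X − cX))` with `2u ≡ 1 (mod p)`.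
[cite: WZhang2014, §5, §9 (9.2)] [cite: GrossLMS1991, §5 (5.1)] [cite: Howard2006, Thm. 3.2.3] -/
theorem forall_eq_zero_of_selQP_eq_bot (hS : Setting W K p κ 𝔭 𝔭') (hH : SatisfiesHeegnerHypothesis (W.conductorNorm ℤ) K)
    (hloc : hatleyLeiVigni2022_lemma37_local_signedCondition_eq_kummer W K p κ 𝔭 𝔭') (h5 : 5 ≤ p) {N : ℕ} (hN : (N : ℤ) = W.conductorNorm ℤ)
    (hND : IsCoprime (N : ℤ) (NumberField.discr K))
    (hall : ∀ q : ℕ, q.Prime → q ∣ N → ∃ v' : HeightOneSpectrum (𝓞 ℚ), ((q : ℕ) : 𝓞 ℚ) ∈ v'.asIdeal ∧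
      ∃ 𝔓 ∈ v'.primesAbove, ∃ σ ∈ 𝔓.inertia (absoluteGaloisGroup ℚ), ∃ P : W.geomTorsion (p : ℤ), σ • P ≠ P)
    (hc1 : c ≠ 1) (ε : ℤˣ) {s : Finset (AdmQ W K p)} (hzero : ∀ μ : Bool, SelQP W K p c s μ = ⊥) :
    ∀ x ∈ signedOrdSelmerTorsion (W.baseChange K) p κ ε (∏ q ∈ s, (q : ℕ)) 0 1, x = 0 := by
  intro x hx
  have hp : p.Prime := Fact.out
  have hp2 : p ≠ 2 := by omega
  have hK := hS.isImaginaryQuadratic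
  have hcc : c * c = 1 :=
    (algEquiv_eq_one_or_eq_of_finrank_two hK.1 hc1 (c * c)).elim id
      fun h ↦ absurd (mul_left_cancel (h.trans (mul_one c).symm)) hc1
  have hKc : ∀ w : InfinitePlace K, w.IsComplex := hK.2.isComplex
  obtain ⟨X, rfl⟩ := exists_resH1Hom_layerZero_eq W κ x
  have hX := (mem_levelBlocks_iff_resH1Hom_mem W κ hS hH hloc h5 hN hND hall ε s X).mpr hx
  have hcX := conjAct_mem_levelBlocks W p c hKc (s.image Subtype.val) hX
  set τ := conjAct W c ((p ^ 1 : ℕ) : ℤ) with hτ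
  have hττ : τ (τ X) = X := conjAct_conjAct_of_mul_self W hcc ((p ^ 1 : ℕ) : ℤ) X
  -- the two eigen-components lie in the two eigen-cuts, which are the `SelQP`s, hence vanish
  have hplus : X + τ X ∈ levelSelmerSubgroupP W K p c (s.image Subtype.val) ∅ true := by
    rw [levelSelmerSubgroupP_eq_ker_inf]
    refine AddSubgroup.mem_inf.mpr ⟨?_, add_mem hX hcX⟩
    rw [AddMonoidHom.mem_ker]
    show τ (X + τ X) - sgnP true • (X + τ X) = 0
    rw [show sgnP true = (1 : ℤ) from rfl, one_zsmul, map_add, hττ]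
    abel
  have hminus : X - τ X ∈ levelSelmerSubgroupP W K p c (s.image Subtype.val) ∅ false := by
    rw [levelSelmerSubgroupP_eq_ker_inf]
    refine AddSubgroup.mem_inf.mpr ⟨?_, sub_mem hX hcX⟩
    rw [AddMonoidHom.mem_ker]
    show τ (X - τ X) - sgnP false • (X - τ X) = 0
    rw [show sgnP false = (-1 : ℤ) from rfl, neg_one_zsmul, map_sub, hττ]
    abel
  have h0plus : X + τ X = 0 := by
    have h : X + τ X ∈ SelQP W K p c s true := by
      unfold SelQP; rw [AddSubgroup.mem_toZModSubmodule]; exact hplus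
    rw [hzero true] at h
    exact (Submodule.mem_bot (R := ZMod p)).mp h
  have h0minus : X - τ X = 0 := by
    have h : X - τ X ∈ SelQP W K p c s false := by
      unfold SelQP; rw [AddSubgroup.mem_toZModSubmodule]; exact hminus
    rw [hzero false] at h
    exact (Submodule.mem_bot (R := ZMod p)).mp h
  -- `2u ≡ 1 (mod p)`: `X = u • ((X + τ X) + (X − τ X)) = 0`
  obtain ⟨u, hu⟩ := exists_two_mul_zsmul_eq_of_odd W K p (hp.odd_of_ne_two hp2)
  have hX0 : X = 0 := by
    have h2 : (2 : ℤ) • X = (X + τ X) + (X - τ X) := by rw [two_zsmul]; abel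
    calc X = (2 * u) • X := (hu X).symm
      _ = u • ((2 : ℤ) • X) := by rw [mul_comm, mul_zsmul]
      _ = 0 := by rw [h2, h0plus, h0minus, add_zero, zsmul_zero]
  rw [hX0, map_zero]

/-- ★ **A CHKLL zero vertex is an AKR zero vertex**: on cell β (hypotheses of §2), if every class of `Sel^ε_{∏s}(K_0, E[p])` is zero then both
eigen-spaces `SelQP W K p c s ±` vanish (a class of `SelQP s μ` lies in `D_s`, so `T` of it lies in `Sel^ε = 0`, and `T` is injective).
[cite: WZhang2014, §5] [cite: CastellaEtAl2025, §7.2] -/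
theorem selQP_eq_bot_of_forall_eq_zero (hS : Setting W K p κ 𝔭 𝔭') (hH : SatisfiesHeegnerHypothesis (W.conductorNorm ℤ) K)
    (hloc : hatleyLeiVigni2022_lemma37_local_signedCondition_eq_kummer W K p κ 𝔭 𝔭') (h5 : 5 ≤ p) {N : ℕ} (hN : (N : ℤ) = W.conductorNorm ℤ)
    (hND : IsCoprime (N : ℤ) (NumberField.discr K))
    (hall : ∀ q : ℕ, q.Prime → q ∣ N → ∃ v' : HeightOneSpectrum (𝓞 ℚ), ((q : ℕ) : 𝓞 ℚ) ∈ v'.asIdeal ∧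
      ∃ 𝔓 ∈ v'.primesAbove, ∃ σ ∈ 𝔓.inertia (absoluteGaloisGroup ℚ), ∃ P : W.geomTorsion (p : ℤ), σ • P ≠ P)
    (ε : ℤˣ) {s : Finset (AdmQ W K p)}
    (hzero : ∀ x ∈ signedOrdSelmerTorsion (W.baseChange K) p κ ε (∏ q ∈ s, (q : ℕ)) 0 1, x = 0) :
    ∀ μ : Bool, SelQP W K p c s μ = ⊥ := by
  intro μ
  refine (Submodule.eq_bot_iff _).mpr fun X hX ↦ ?_
  have hX' : X ∈ levelSelmerSubgroupP W K p c (s.image Subtype.val) ∅ μ := by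
    unfold SelQP at hX; rwa [AddSubgroup.mem_toZModSubmodule] at hX
  rw [levelSelmerSubgroupP_eq_ker_inf] at hX'
  have hD := (AddSubgroup.mem_inf.mp hX').2
  have hT := (mem_levelBlocks_iff_resH1Hom_mem W κ hS hH hloc h5 hN hND hall ε s X).mp hD
  by_contra hX0
  exact res_layerZero_ne_zero W κ hX0 (hzero _ hT)

/-- **«Zero vertex» in the two currencies** (§3 both ways). [cite: WZhang2014, §5] [cite: CastellaEtAl2025, §7.2] [cite: Howard2006, Thm. 3.2.3] -/
theorem selQP_eq_bot_iff_forall_eq_zero (hS : Setting W K p κ 𝔭 𝔭') (hH : SatisfiesHeegnerHypothesis (W.conductorNorm ℤ) K)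
    (hloc : hatleyLeiVigni2022_lemma37_local_signedCondition_eq_kummer W K p κ 𝔭 𝔭') (h5 : 5 ≤ p) {N : ℕ} (hN : (N : ℤ) = W.conductorNorm ℤ)
    (hND : IsCoprime (N : ℤ) (NumberField.discr K))
    (hall : ∀ q : ℕ, q.Prime → q ∣ N → ∃ v' : HeightOneSpectrum (𝓞 ℚ), ((q : ℕ) : 𝓞 ℚ) ∈ v'.asIdeal ∧
      ∃ 𝔓 ∈ v'.primesAbove, ∃ σ ∈ 𝔓.inertia (absoluteGaloisGroup ℚ), ∃ P : W.geomTorsion (p : ℤ), σ • P ≠ P)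
    (hc1 : c ≠ 1) (ε : ℤˣ) (s : Finset (AdmQ W K p)) :
    (∀ μ : Bool, SelQP W K p c s μ = ⊥) ↔
      ∀ x ∈ signedOrdSelmerTorsion (W.baseChange K) p κ ε (∏ q ∈ s, (q : ℕ)) 0 1, x = 0 :=
  ⟨forall_eq_zero_of_selQP_eq_bot W κ c hS hH hloc h5 hN hND hall hc1 ε,
    selQP_eq_bot_of_forall_eq_zero W κ c hS hH hloc h5 hN hND hall ε⟩

end Zero

end Summit.BirchSwinnertonDyer.BirchSwinnertonDyer.Theorems.SignedBaseChangeAcDivAdmdefZeroVertexDictionary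

end
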